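import Summits.Ventures.Crystal3D.Theorems.StickyWulffConstantTextureLiminfTexShadowSteepPlateLaunch
import Summits.Ventures.Crystal3D.Theorems.StickyWulffConstantTextureLiminfTexShadowSteerCombo
import HarnessLib

/-!
# TexShadow row (e) / EDGE-ON flux-pair sliver: the TWO-STEERING launch of one slot — model geometry (file 1 of 2)
# (lane T, crux `TextureLiminfV5`, stmt-Ventures-23912, sub-crux EDGE-ON, successor stub `stub_edgeOnFlux` of v8.10; cf-p1 rulings
# (clxxv)(2) / (clxxxi)(ii) / (clxxxiii); memo HOME/wall-p1-g15/STEEP-PLATE-g15.md §5d «k = 4 closes the flux-pair sliver»)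

HONEST FRAMING. Venture `Summits/Ventures/Crystal3D` (cell `crystal3d-full`), route `route-Ventures-StickyWulffConstant`, helper
`--supports` the law-v5 crux `TextureLiminfV5` (stmt-Ventures-23912).  Elementary Euclidean geometry of the six reference directions of a
presented Barlow plate (three up-slots `u_k`, three capper directions `−M u_k`, `M` = basal mirror); standard axioms; NO certificate and NO
wall statement is proved here; rung F-C1 not moved.

THE POINT (memo §5d).  The two-sided wide-steered ledger (`BarlowTwoSidedCertifiedSteerWide`, p705084; represented menu p709650) charges a
bilayer pair against `steerRise₁ i + steerRise₂ j`: on a Δ-bilayer the launch slot's rise, on a ∇-bilayer the rise of the `z`-BEST CAPPER of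
the steering `z`.  With ONE steering per plate the per-plate strength `b(ν) = max min(slot, capper)` dips to `1/(2√3) ≈ 0.289` (wall normal
along a capper azimuth), so the FLUX-PAIR SLIVER `{b₁ + b₂ < √2·13/25}` is thin but non-empty (Haar mean 0.07 % of H).  Steering the SAME
slot `v` by TWO steerings `z, z′` whose best cappers are the two cappers ADJACENT to `v` (the two sub-families share their Δ-walkers and
split on ∇-bilayers) replaces `capper` by `capper + capper′ ≥ slot`, and the sliver closes: this file and its sequel prove that EVERY
plate, in its given or its twin presentation (`twinRepFrame`, p709650), admits either ONE steering with `min(slot, capper) ≥ 3/8` or TWO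
steerings with distinct adjacent cappers, both capper rises `≥ 1/10` (the ∇-floor cf-p1 keyed in (clxxxiii)) and `slot ≥ 3/8`,
`capper + capper′ ≥ 3/8`; and `3/8 + 3/8 ≥ √2·13/25`.

THIS FILE (model coordinates; `ν` = the pulled-back wall normal, `ν₂ ≥ 0`):
* Gram tables of the six directions (`inner_upSlot_upSlot`, `inner_basalMirror_upSlot_upSlot'`, `upSlots_ne`), the rise relations
  `upSlot_rises` (`Σ slot rises = 3H`, `2 Σ (slot − H)² + (3/2) H² = 1`, `H = √(2/3) ν₂`) and `capperRise_eq` (`capper = 2H − slot`);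
* `fluxPair_double_core` — the real-arithmetic heart of the two-steering branch: in the coordinates `(pk, Q, H)` of the nearest
  direction, `near capper < 3/8` forces `pk ≥ 0.567`, `far capper ≥ 1/10`, and the explicit steering within chord `1/3`;
* the EXPLICIT second steering `ζ = (570/589) v − (1/589) M w + (430/589) M v` (exact unit vector in the `ℚ`-Gram lattice of
  `v, M w, M v`): `norm_dblSteer`, `inner_slot_dblSteer` (`= 855/1178 ≥ √2/2`), `inner_basalMirror_dblSteer_*` (the capper `−M w` is
  the STRICT `ζ`-best capper: `−522/1178 < −521/1178 < 479/1178`), `inner_dblSteer_axis`;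
* `capperRise_ge_of_minimiser` — for the one-steering branch (`ζ = α v + β ν` of `exists_model_steering`): every `ζ`-best capper rises
  at least as much as each capper adjacent to `v`.
WHAT THIS IS NOT: no certificate; the walker-side same-base additivity (α) and the floor-1/10 window lemma (β) are lane G's; F-C1 not moved.
-/

noncomputable section

open scoped BigOperators InnerProductSpace

namespace Summit.Ventures.Crystal3D.Cruxes.TextureLiminf.TexShadow

open Summit.Ventures.Crystal3D Summit.Ventures.Crystal3D.Theorems
open Literature.MathematicalPhysics.StatisticalMechanics (basalMirror)

/-! ## The six reference directions: distinctness and Gram tables -/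

/-- The three reference up-slots are pairwise distinct. -/
theorem upSlots_ne : upSlot₁ ≠ upSlot₂ ∧ upSlot₁ ≠ upSlot₃ ∧ upSlot₂ ≠ upSlot₃ := by
  obtain ⟨⟨a0, -, -⟩, ⟨b0, -, -⟩, ⟨c0, -, -⟩⟩ := upSlot_coords
  refine ⟨fun h => ?_, fun h => ?_, fun h => ?_⟩
  · have h' := congrArg (fun w : E3 => w 0) h
    simp only at h'; rw [a0, b0] at h'; norm_num at h'
  · have h' := congrArg (fun w : E3 => w 0) h
    simp only at h'; rw [a0, c0] at h'; norm_num at h'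
  · have h' := congrArg (fun w : E3 => w 0) h
    simp only at h'; rw [b0, c0] at h'; norm_num at h'

/-- Reference up-slots are unit vectors. -/
theorem norm_upSlot_eq_one {w : E3} (hw : w = upSlot₁ ∨ w = upSlot₂ ∨ w = upSlot₃) : ‖w‖ = 1 := by
  obtain ⟨h1, h2, h3⟩ := upSlots_mem_fccSlots
  rcases hw with rfl | rfl | rfl
  · exact norm_eq_one_of_mem_fccSlots h1
  · exact norm_eq_one_of_mem_fccSlots h2
  · exact norm_eq_one_of_mem_fccSlots h3

/-- **Gram table of the up-slots**: `⟪w, u⟫ = 1` if `w = u`, `1/2` otherwise. -/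
theorem inner_upSlot_upSlot {w u : E3} (hw : w = upSlot₁ ∨ w = upSlot₂ ∨ w = upSlot₃) (hu : u = upSlot₁ ∨ u = upSlot₂ ∨ u = upSlot₃) :
    ⟪w, u⟫_ℝ = if w = u then 1 else 1 / 2 := by
  split_ifs with h
  · rw [h, real_inner_self_eq_norm_sq, norm_upSlot_eq_one hu, one_pow]
  · exact (inner_upSlots hw hu).2 h

/-- **Gram table slot/capper**: `⟪M w, u⟫ = −1/3` if `w = u`, `−5/6` otherwise (`M` = basal mirror). -/
theorem inner_basalMirror_upSlot_upSlot' {w u : E3} (hw : w = upSlot₁ ∨ w = upSlot₂ ∨ w = upSlot₃)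
    (hu : u = upSlot₁ ∨ u = upSlot₂ ∨ u = upSlot₃) :
    ⟪basalMirror w, u⟫_ℝ = if w = u then -(1 / 3) else -(5 / 6) := by
  obtain ⟨t11, t12, t13, t21, t22, t23, t31, t32, t33⟩ := inner_basalMirror_upSlot_upSlot
  obtain ⟨n12, n13, n23⟩ := upSlots_ne
  rcases hw with rfl | rfl | rfl <;> rcases hu with rfl | rfl | rfl
  · rw [if_pos rfl]; exact t11
  · rw [if_neg n12]; exact t12
  · rw [if_neg n13]; exact t13
  · rw [if_neg (Ne.symm n12)]; exact t21
  · rw [if_pos rfl]; exact t22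
  · rw [if_neg n23]; exact t23
  · rw [if_neg (Ne.symm n13)]; exact t31
  · rw [if_neg (Ne.symm n23)]; exact t32
  · rw [if_pos rfl]; exact t33

/-- The basal mirror is an isometry: `⟪M w, M u⟫ = ⟪w, u⟫`. -/
theorem inner_basalMirror_basalMirror (w u : E3) : ⟪basalMirror w, basalMirror u⟫_ℝ = ⟪w, u⟫_ℝ :=
  LinearIsometryEquiv.inner_map_map basalMirror w u

/-! ## Rises: slot + capper = 2H, and the sphere relation -/

/-- **Capper rise**: for a reference up-slot `u` and any `ν`, the rise of the capper direction `−M u` is `2H − ⟪u, ν⟫`, `H = √(2/3)·ν₂`. -/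
theorem capperRise_eq {u : E3} (hu : u = upSlot₁ ∨ u = upSlot₂ ∨ u = upSlot₃) (ν : E3) :
    -⟪basalMirror u, ν⟫_ℝ = 2 * (Real.sqrt (2 / 3) * ν 2) - ⟪u, ν⟫_ℝ := by
  have h : ∀ a b : E3, ⟪a, b⟫_ℝ = a 0 * b 0 + a 1 * b 1 + a 2 * b 2 := fun a b => by
    simp [PiLp.inner_apply, Fin.sum_univ_three, mul_comm]
  rw [inner_basalMirror_fin3, h, (upSlot_lateral hu).2]; ring

/-- **The rise relations of the three up-slots** for a UNIT model axis `ν` (`H = √(2/3)·ν₂`): the slot rises sum to `3H`, and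
`2·Σ (slot − H)² + (3/2)·H² = 1` (the lateral parts of the three slots form a tight frame of the horizontal plane). -/
theorem upSlot_rises (ν : E3) (hν : ‖ν‖ = 1) :
    ⟪upSlot₁, ν⟫_ℝ + ⟪upSlot₂, ν⟫_ℝ + ⟪upSlot₃, ν⟫_ℝ = 3 * (Real.sqrt (2 / 3) * ν 2) ∧
    2 * ((⟪upSlot₁, ν⟫_ℝ - Real.sqrt (2 / 3) * ν 2) ^ 2 + (⟪upSlot₂, ν⟫_ℝ - Real.sqrt (2 / 3) * ν 2) ^ 2 +
        (⟪upSlot₃, ν⟫_ℝ - Real.sqrt (2 / 3) * ν 2) ^ 2) + 3 / 2 * (Real.sqrt (2 / 3) * ν 2) ^ 2 = 1 := by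
  have h3 : Real.sqrt 3 ^ 2 = 3 := Real.sq_sqrt (by norm_num)
  have h23 : Real.sqrt (2 / 3) ^ 2 = 2 / 3 := Real.sq_sqrt (by norm_num)
  have hunit : ν 0 ^ 2 + ν 1 ^ 2 + ν 2 ^ 2 = 1 := by
    have h := real_inner_self_eq_norm_sq ν
    have h' : ∀ a b : E3, ⟪a, b⟫_ℝ = a 0 * b 0 + a 1 * b 1 + a 2 * b 2 := fun a b => by
      simp [PiLp.inner_apply, Fin.sum_univ_three, mul_comm]
    rw [hν, one_pow, h'] at h
    linear_combination h
  obtain ⟨s1, s2, s3⟩ := inner_upSlot_fin3 ν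
  rw [s1, s2, s3]
  constructor
  · ring
  · linear_combination hunit + (ν 1 ^ 2 / 3) * h3 + (3 / 2 * ν 2 ^ 2) * h23

/-- **The rise relations, presented from a launch slot**: `v, wa, wb` the three reference up-slots in any order; slot rises `A, Sa, Sb`. -/
theorem slot_rises_perm {v wa wb : E3} (hv : v = upSlot₁ ∨ v = upSlot₂ ∨ v = upSlot₃) (hwa : wa = upSlot₁ ∨ wa = upSlot₂ ∨ wa = upSlot₃)
    (hwb : wb = upSlot₁ ∨ wb = upSlot₂ ∨ wb = upSlot₃) (hav : wa ≠ v) (hbv : wb ≠ v) (hab : wa ≠ wb) (ν : E3) (hν : ‖ν‖ = 1) :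
    ⟪v, ν⟫_ℝ + ⟪wa, ν⟫_ℝ + ⟪wb, ν⟫_ℝ = 3 * (Real.sqrt (2 / 3) * ν 2) ∧
    2 * ((⟪v, ν⟫_ℝ - Real.sqrt (2 / 3) * ν 2) ^ 2 + (⟪wa, ν⟫_ℝ - Real.sqrt (2 / 3) * ν 2) ^ 2 +
        (⟪wb, ν⟫_ℝ - Real.sqrt (2 / 3) * ν 2) ^ 2) + 3 / 2 * (Real.sqrt (2 / 3) * ν 2) ^ 2 = 1 := by
  obtain ⟨hsum, hsph⟩ := upSlot_rises ν hν
  rcases hv with rfl | rfl | rfl <;> rcases hwa with rfl | rfl | rfl <;> rcases hwb with rfl | rfl | rfl <;>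
    first
    | exact absurd rfl hav
    | exact absurd rfl hbv
    | exact absurd rfl hab
    | exact ⟨by linarith, by linear_combination hsph⟩

/-! ## The real-arithmetic core of the two-steering branch -/

/-- **Two-steering branch, real core.**  Coordinates of a unit model axis relative to its nearest direction `v`: `pk` (lateral component
along `v`'s azimuth), `Q ≥ 0` (= near capper rise − far capper rise), `H ≥ 0` (`√(2/3)` × axial component), `3 pk² + Q² + (3/2) H² = 1`,
`Q ≤ pk` (the slot out-rises its near capper); near capper rise `H + pk/2 + Q/2 < 3/8`.  THEN `pk ≥ 0.567`, the far capper rises by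
`H + pk/2 − Q/2 ≥ 1/10`, and the explicit second steering lies within chord `1/3` of the axis:
`(570/589)(H + pk) + (1/589)(H + pk/2 − Q/2) − (430/589)(H − pk) ≥ 17/18`. -/
theorem fluxPair_double_core (pk Q H : ℝ) (hH : 0 ≤ H) (hQ0 : 0 ≤ Q) (hQ : Q ≤ pk)
    (hsph : 3 * pk ^ 2 + Q ^ 2 + 3 / 2 * H ^ 2 = 1) (hD : H + pk / 2 + Q / 2 < 3 / 8) :
    567 / 1000 ≤ pk ∧ 1 / 10 ≤ H + pk / 2 - Q / 2 ∧
      17 / 18 ≤ (570 / 589 : ℝ) * (H + pk) + (1 / 589 : ℝ) * (H + pk / 2 - Q / 2) - (430 / 589 : ℝ) * (H - pk) := by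
  have hpk0 : 0 ≤ pk := hQ0.trans hQ
  have hQ1 : Q ≤ 3 / 4 - 2 * H - pk := by linarith
  have hQ2 : Q ^ 2 ≤ (3 / 4 - 2 * H - pk) ^ 2 := by
    have h0 : 0 ≤ 3 / 4 - 2 * H - pk := hQ0.trans hQ1
    nlinarith
  have hneg : H * (11 / 2 * H + 4 * pk - 3) ≤ 0 := by
    have : 11 / 2 * H + 4 * pk - 3 ≤ 0 := by nlinarith
    nlinarith
  have hquad : 0 ≤ 4 * pk ^ 2 - 3 / 2 * pk - 7 / 16 := by nlinarith
  have hpk : 567 / 1000 ≤ pk := by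
    by_contra hcon
    have hlt : pk < 567 / 1000 := lt_of_not_ge hcon
    nlinarith
  refine ⟨hpk, by linarith, by linarith⟩

/-! ## The explicit second steering `ζ = (570/589) v − (1/589) M w + (430/589) M v` -/

/-- **Unit length**: for distinct reference up-slots `v, w`, `‖(570/589) v − (1/589) M w + (430/589) M v‖ = 1` (exact, in the
`ℚ`-Gram lattice `⟪v, Mw⟫ = −5/6`, `⟪v, Mv⟫ = −1/3`, `⟪Mw, Mv⟫ = 1/2`). -/
theorem norm_dblSteer {v w : E3} (hv : v = upSlot₁ ∨ v = upSlot₂ ∨ v = upSlot₃) (hw : w = upSlot₁ ∨ w = upSlot₂ ∨ w = upSlot₃)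
    (hwv : w ≠ v) :
    ‖(570 / 589 : ℝ) • v - (1 / 589 : ℝ) • basalMirror w + (430 / 589 : ℝ) • basalMirror v‖ = 1 := by
  have gvv : ⟪v, v⟫_ℝ = 1 := by rw [inner_upSlot_upSlot hv hv, if_pos rfl]
  have gww : ⟪basalMirror w, basalMirror w⟫_ℝ = 1 := by rw [inner_basalMirror_basalMirror, inner_upSlot_upSlot hw hw, if_pos rfl]
  have gMvMv : ⟪basalMirror v, basalMirror v⟫_ℝ = 1 := by rw [inner_basalMirror_basalMirror, inner_upSlot_upSlot hv hv, if_pos rfl]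
  have gwv : ⟪basalMirror w, v⟫_ℝ = -(5 / 6) := by rw [inner_basalMirror_upSlot_upSlot' hw hv, if_neg hwv]
  have gvw : ⟪v, basalMirror w⟫_ℝ = -(5 / 6) := by rw [real_inner_comm, gwv]
  have gMvv : ⟪basalMirror v, v⟫_ℝ = -(1 / 3) := by rw [inner_basalMirror_upSlot_upSlot' hv hv, if_pos rfl]
  have gvMv : ⟪v, basalMirror v⟫_ℝ = -(1 / 3) := by rw [real_inner_comm, gMvv]
  have gwMv : ⟪basalMirror w, basalMirror v⟫_ℝ = 1 / 2 := by rw [inner_basalMirror_basalMirror, inner_upSlot_upSlot hw hv, if_neg hwv]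
  have gMvw : ⟪basalMirror v, basalMirror w⟫_ℝ = 1 / 2 := by rw [real_inner_comm, gwMv]
  set ζ := (570 / 589 : ℝ) • v - (1 / 589 : ℝ) • basalMirror w + (430 / 589 : ℝ) • basalMirror v with hζ
  have hsq : ⟪ζ, ζ⟫_ℝ = 1 := by
    simp only [hζ, inner_add_left, inner_add_right, inner_sub_left, inner_sub_right, real_inner_smul_left, real_inner_smul_right,
      gvv, gww, gMvMv, gwv, gvw, gMvv, gvMv, gwMv, gMvw]
    norm_num
  have h1 : ‖ζ‖ ^ 2 = 1 ^ 2 := by rw [← real_inner_self_eq_norm_sq, hsq, one_pow]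
  exact (sq_eq_sq₀ (norm_nonneg _) zero_le_one).1 h1

/-- **Steepness of the launch slot for the second steering**: `⟪v, ζ⟫ = 855/1178` (`≈ 0.7258`). -/
theorem inner_slot_dblSteer {v w : E3} (hv : v = upSlot₁ ∨ v = upSlot₂ ∨ v = upSlot₃) (hw : w = upSlot₁ ∨ w = upSlot₂ ∨ w = upSlot₃)
    (hwv : w ≠ v) :
    ⟪v, (570 / 589 : ℝ) • v - (1 / 589 : ℝ) • basalMirror w + (430 / 589 : ℝ) • basalMirror v⟫_ℝ = 855 / 1178 := by
  have gvv : ⟪v, v⟫_ℝ = 1 := by rw [inner_upSlot_upSlot hv hv, if_pos rfl]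
  have gvw : ⟪v, basalMirror w⟫_ℝ = -(5 / 6) := by rw [real_inner_comm, inner_basalMirror_upSlot_upSlot' hw hv, if_neg hwv]
  have gvMv : ⟪v, basalMirror v⟫_ℝ = -(1 / 3) := by rw [real_inner_comm, inner_basalMirror_upSlot_upSlot' hv hv, if_pos rfl]
  simp only [inner_add_right, inner_sub_right, real_inner_smul_right, gvv, gvw, gvMv]
  norm_num

/-- `855/1178 ≥ √2/2`: the launch slot is steep for the second steering. -/
theorem sqrt_two_div_two_le_855_1178 : Real.sqrt 2 / 2 ≤ 855 / 1178 := by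
  rw [div_le_iff₀ (by norm_num : (0:ℝ) < 2)]
  have h : Real.sqrt 2 ≤ Real.sqrt ((855 / 1178 * 2) ^ 2) := Real.sqrt_le_sqrt (by norm_num)
  rwa [Real.sqrt_sq (by norm_num)] at h

/-- **The second steering's inner products with the three mirrored up-slots** (`v` the launch slot, `w` the steered-to capper's slot,
`w'` the third): `⟪M w, ζ⟫ = −522/1178`, `⟪M w', ζ⟫ = −521/1178`, `⟪M v, ζ⟫ = 479/1178` — so `w` is the STRICT minimiser and
`−w` the unique `ζ`-best capper. -/
theorem inner_basalMirror_dblSteer {v w w' : E3} (hv : v = upSlot₁ ∨ v = upSlot₂ ∨ v = upSlot₃)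
    (hw : w = upSlot₁ ∨ w = upSlot₂ ∨ w = upSlot₃) (hw' : w' = upSlot₁ ∨ w' = upSlot₂ ∨ w' = upSlot₃)
    (hwv : w ≠ v) (hw'v : w' ≠ v) (hww' : w ≠ w') :
    ⟪basalMirror w, (570 / 589 : ℝ) • v - (1 / 589 : ℝ) • basalMirror w + (430 / 589 : ℝ) • basalMirror v⟫_ℝ = -(522 / 1178) ∧
    ⟪basalMirror w', (570 / 589 : ℝ) • v - (1 / 589 : ℝ) • basalMirror w + (430 / 589 : ℝ) • basalMirror v⟫_ℝ = -(521 / 1178) ∧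
    ⟪basalMirror v, (570 / 589 : ℝ) • v - (1 / 589 : ℝ) • basalMirror w + (430 / 589 : ℝ) • basalMirror v⟫_ℝ = 479 / 1178 := by
  have gwv : ⟪basalMirror w, v⟫_ℝ = -(5 / 6) := by rw [inner_basalMirror_upSlot_upSlot' hw hv, if_neg hwv]
  have gw'v : ⟪basalMirror w', v⟫_ℝ = -(5 / 6) := by rw [inner_basalMirror_upSlot_upSlot' hw' hv, if_neg hw'v]
  have gMvv : ⟪basalMirror v, v⟫_ℝ = -(1 / 3) := by rw [inner_basalMirror_upSlot_upSlot' hv hv, if_pos rfl]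
  have gww : ⟪basalMirror w, basalMirror w⟫_ℝ = 1 := by rw [inner_basalMirror_basalMirror, inner_upSlot_upSlot hw hw, if_pos rfl]
  have gw'w : ⟪basalMirror w', basalMirror w⟫_ℝ = 1 / 2 := by
    rw [inner_basalMirror_basalMirror, inner_upSlot_upSlot hw' hw, if_neg (Ne.symm hww')]
  have gMvw : ⟪basalMirror v, basalMirror w⟫_ℝ = 1 / 2 := by
    rw [inner_basalMirror_basalMirror, inner_upSlot_upSlot hv hw, if_neg (Ne.symm hwv)]
  have gwMv : ⟪basalMirror w, basalMirror v⟫_ℝ = 1 / 2 := by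
    rw [inner_basalMirror_basalMirror, inner_upSlot_upSlot hw hv, if_neg hwv]
  have gw'Mv : ⟪basalMirror w', basalMirror v⟫_ℝ = 1 / 2 := by
    rw [inner_basalMirror_basalMirror, inner_upSlot_upSlot hw' hv, if_neg hw'v]
  have gMvMv : ⟪basalMirror v, basalMirror v⟫_ℝ = 1 := by rw [inner_basalMirror_basalMirror, inner_upSlot_upSlot hv hv, if_pos rfl]
  refine ⟨?_, ?_, ?_⟩
  · simp only [inner_add_right, inner_sub_right, real_inner_smul_right, gwv, gww, gwMv]; norm_num
  · simp only [inner_add_right, inner_sub_right, real_inner_smul_right, gw'v, gw'w, gw'Mv]; norm_num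
  · simp only [inner_add_right, inner_sub_right, real_inner_smul_right, gMvv, gMvw, gMvMv]; norm_num

/-- **The second steering against the model axis**: `⟪ζ, ν⟫ = (570/589)⟪v, ν⟫ + (1/589)(−⟪M w, ν⟫) − (430/589)(−⟪M v, ν⟫)`. -/
theorem inner_dblSteer_axis (v w ν : E3) :
    ⟪(570 / 589 : ℝ) • v - (1 / 589 : ℝ) • basalMirror w + (430 / 589 : ℝ) • basalMirror v, ν⟫_ℝ =
      (570 / 589 : ℝ) * ⟪v, ν⟫_ℝ + (1 / 589 : ℝ) * (-⟪basalMirror w, ν⟫_ℝ) - (430 / 589 : ℝ) * (-⟪basalMirror v, ν⟫_ℝ) := by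
  simp only [inner_add_left, inner_sub_left, real_inner_smul_left]; ring

/-! ## The one-steering branch: the best capper out-rises both adjacent cappers -/

/-- **One steering, the best capper is at least an adjacent capper.**  `v` a reference up-slot, `ζ = α v + β ν` (`α ≥ 0 < β`) a steering,
`u` a reference up-slot minimising `⟪M ·, ζ⟫` (so `−u` is a `ζ`-best capper); then for every reference up-slot `w' ≠ v` the capper `−M u`
rises at least as much as `−M w'` along `ν`: `−⟪M w', ν⟫ ≤ −⟪M u, ν⟫`. -/
theorem capperRise_ge_of_minimiser {v ν ζ u w' : E3} {α β : ℝ} (hv : v = upSlot₁ ∨ v = upSlot₂ ∨ v = upSlot₃) (hα : 0 ≤ α) (hβ : 0 < β)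
    (hζ : ζ = α • v + β • ν) (hu : u = upSlot₁ ∨ u = upSlot₂ ∨ u = upSlot₃)
    (hmin : ∀ w, (w = upSlot₁ ∨ w = upSlot₂ ∨ w = upSlot₃) → ⟪basalMirror u, ζ⟫_ℝ ≤ ⟪basalMirror w, ζ⟫_ℝ)
    (hw' : w' = upSlot₁ ∨ w' = upSlot₂ ∨ w' = upSlot₃) (hw'v : w' ≠ v) :
    -⟪basalMirror w', ν⟫_ℝ ≤ -⟪basalMirror u, ν⟫_ℝ := by
  have hexp : ∀ w, (w = upSlot₁ ∨ w = upSlot₂ ∨ w = upSlot₃) →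
      ⟪basalMirror w, ζ⟫_ℝ = α * (if w = v then -(1 / 3) else -(5 / 6)) + β * ⟪basalMirror w, ν⟫_ℝ := by
    intro w hw
    rw [hζ, inner_add_right, real_inner_smul_right, real_inner_smul_right, inner_basalMirror_upSlot_upSlot' hw hv]
  by_cases huw : u = w'
  · rw [huw]
  have h := hmin w' hw'
  rw [hexp u hu, hexp w' hw', if_neg hw'v] at h
  by_cases huv : u = v
  · rw [if_pos huv] at h
    have : β * (⟪basalMirror u, ν⟫_ℝ - ⟪basalMirror w', ν⟫_ℝ) ≤ -(α / 2) := by linarith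
    have h2 : ⟪basalMirror u, ν⟫_ℝ - ⟪basalMirror w', ν⟫_ℝ ≤ 0 := by
      by_contra hcon
      have : 0 < β * (⟪basalMirror u, ν⟫_ℝ - ⟪basalMirror w', ν⟫_ℝ) := mul_pos hβ (lt_of_not_ge hcon)
      linarith
    linarith
  · rw [if_neg huv] at h
    have : β * (⟪basalMirror u, ν⟫_ℝ - ⟪basalMirror w', ν⟫_ℝ) ≤ 0 := by linarith
    have h2 : ⟪basalMirror u, ν⟫_ℝ - ⟪basalMirror w', ν⟫_ℝ ≤ 0 := by
      by_contra hcon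
      have : 0 < β * (⟪basalMirror u, ν⟫_ℝ - ⟪basalMirror w', ν⟫_ℝ) := mul_pos hβ (lt_of_not_ge hcon)
      linarith
    linarith

end Summit.Ventures.Crystal3D.Cruxes.TextureLiminf.TexShadow

end
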